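import Summits.RiemannHypothesis.RiemannHypothesis.Theorems.TiltedLandingLaw421R3K2NoZFloor

/-!
# TiltedLandingLaw421 — R3 NEAR-COINCIDENT TIE + MASS WINDOW (C1 IMAGE R; director (CA805)(2)/(CA803)(3), sockets 2′/3′ of (CA813)/(CA829))

Regime 2′ `RhW08.K2NoZFloor.HeavyNearCoincidentNoZQ` (β-level above the floor at `v`, toucher `z` NEAR-COINCIDENT `2‖v − z‖ < Im v` ⇒ `X ≥ 5/2`) is cut EXACTLY
along «which lowest state carries the level's empty `3/2`-tent» (`IsLowest` has no tie rule; none is proposed).  §1 (K) OCCUPANCY: for a real entire `f`,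
`f⁽ʲ⁾ ≢ 0`, an atomic touching pair with `|Re z − Re v| ≤ (3/2)·Im v` (e.g. near-coincident) has `1 ≤ tentAt (3/2) f j v` — the tent set lies in a closed
ball by `AtomicPair` + reality, so it is finite (no band hypothesis, no `AnalyticHereditySig`).  §2 the ANCHORED sub-socket (2′ + `tentAt (3/2) f j v < 1` at
the β-level's own `v`) is PROVED (vacuous by §1); the TIE sub-socket `HeavyNearCoincidentTieQ` (2′ + a SECOND lowest tracked state `u ≠ v`, `Im u = Im v`,
carrying the empty tent) is typed OPEN; ★★ EXACT glue `HeavyNearCoincidentNoZQ ↔ HeavyNearCoincidentAnchoredQ ∧ HeavyNearCoincidentTieQ`, hence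
`HeavyNearCoincidentNoZQ ↔ HeavyNearCoincidentTieQ`, `NearMassMonotonePairNoZQ μ₀ ↔ HeavyNearCoincidentTieQ ∧ HeavyMassNoZQ μ₀`, and RUNG-P from TIE + MASS(1/2)
(`RhW08.K2NoZFloor.rungP_of_two` by name).  §3 (K) TIE GEOMETRY: under the tie binders `v`'s own tent is occupied and the twin `u` is disc-separated from
the pair — the tie socket is the genuine near-coincident merge estimate on twin-lowest frames, not a clause logic closes.  §4 (K) the MASS WINDOW of
regime 3′: `HeavyMassNoZQ μ₀ ↔ HeavyMassWindowQ μ₀ μ₁ ∧ HeavyMassNoZQ μ₁` (`μ₀ ≤ μ₁`); a window below `μ₁` is closed by any z-floor-free K-2 at `(C, μ₁)` with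
`C(1+μ₁) ≤ 15`; RUNG-P ⇐ TIE + WINDOW(1/2, μ₁] + MASS above `μ₁` — the analytic target of record (CA802)(ii)/(CA803)(3) is `HeavyMassWindowQ (1/2) 1`.
No implication-Props; no `sorry`; no new analytic hypothesis.  RH is not proved; ⟨33346⟩/⟨33347⟩ stay OPEN; only the vacuous anchored socket is proved here.
-/

namespace RhW08.NearCoincidentTie

open Complex
open RhIdea6.G17.W07C7.Rev6 (EngineHyps5)
open RhW07.C12.FieldSplit (IsLowest finite_zeros_closedBall_of_entire)
open RhW08.QuadW (StTrkDQ EmptyTrkDQ)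
open RhIdea6.G21.W07C13.TentMax (tentAt conj_zero_of_real_entire)
open RhW07.C13.Heredity (companions)
open RhIdea6.G22.W07C15pre.Injection (card_le_tentCount_of_subset)
open RhW08.TouchedDissipation (Touches AtomicPair pairUnion childEnergy stateKappa)
open RhW08.PerturbativeRung (BetaLevel RungP)
open RhW08.PerturbativeRung2 (LightPairAt)
open RhW08.K2NoZFloor (HeavyNearCoincidentNoZQ HeavyMassNoZQ NearMassMonotonePairNoZQ PerturbativeDropLightPairNoZQ rungP_of_two
  nearMassMonotonePairNoZQ_iff_split heavyMassNoZQ_mono)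

/-! ## §1 (K) Geometry and occupancy of the near-coincident pair -/

/-- (K) a NEAR-COINCIDENT toucher lies in the `3/2`-strip of `v`: `2‖v − z‖ < Im v ⇒ |Re z − Re v| ≤ (3/2)·Im v` (as `|Re z − Re v| ≤ ‖v − z‖`). -/
theorem abs_re_sub_le_of_nearCoincident {v z : ℂ} (hnc : 2 * ‖v - z‖ < v.im) : |z.re - v.re| ≤ 3 / 2 * v.im := by
  have h := Complex.abs_re_le_norm (z - v)
  rw [Complex.sub_re, ← norm_neg, neg_sub] at h
  linarith [norm_nonneg (v - z)]

/-- (K) contrapositive (crit-1's lemma G): a toucher OUTSIDE the `3/2`-strip of `v` is never near-coincident. -/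
theorem not_nearCoincident_of_strip {v z : ℂ} (hstrip : 3 / 2 * v.im < |z.re - v.re|) : ¬ (2 * ‖v - z‖ < v.im) :=
  fun hnc => absurd (abs_re_sub_le_of_nearCoincident hnc) (not_le.mpr hstrip)

/-- (K) HEIGHT BOUND on `v`'s tent strip for an atomic touching pair of a real entire `f`: a zero `w ≠ v̄` of `f⁽ʲ⁾` with `|Re w − Re v| ≤ (3/2)·Im v` has
`|Im w| ≤ Im z` (upper zeros other than `v`, `z` are below `Im v/2` by `AtomicPair`; lower zeros are conjugates of upper ones by reality). -/
theorem abs_im_le_of_strip {f : ℂ → ℂ} (hf : Differentiable ℂ f) (hreal : ∀ x : ℝ, (f (x : ℂ)).im = 0) {j : ℕ} {v z w : ℂ} (hv : 0 < v.im)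
    (ht : Touches f j v z) (ha : AtomicPair f j v z) (hw0 : iteratedDeriv j f w = 0) (hwre : |w.re - v.re| ≤ 3 / 2 * v.im)
    (hwcv : w ≠ (starRingEnd ℂ) v) : |w.im| ≤ z.im := by
  have hvz : v.im < z.im := ht.2.1
  have hup : ∀ y : ℂ, iteratedDeriv j f y = 0 → 0 < y.im → y ≠ v → |y.re - v.re| ≤ 3 / 2 * v.im → y.im ≤ z.im := by
    intro y hy0 hypos hyv hyre
    by_cases hyz : y = z
    · rw [hyz]
    · have h1 := (ha y hy0 hypos hyv hyz).1
      rw [abs_sub_comm] at h1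
      linarith
  rcases lt_trichotomy 0 w.im with hpos | hzero | hneg
  · by_cases hwv : w = v
    · rw [hwv, abs_of_pos hv]; exact hvz.le
    · rw [abs_of_pos hpos]; exact hup w hw0 hpos hwv hwre
  · rw [← hzero, abs_zero]; linarith
  · have hgd : Differentiable ℂ (iteratedDeriv j f) := Literature.Analysis.Complex.differentiable_iteratedDeriv_of_entire hf j
    have hc0 : iteratedDeriv j f ((starRingEnd ℂ) w) = 0 :=
      conj_zero_of_real_entire hgd (fun x => Literature.Analysis.Complex.im_iteratedDeriv_ofReal hf hreal j x) hw0
    have hcv : (starRingEnd ℂ) w ≠ v := fun h => hwcv (by rw [← h, Complex.conj_conj])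
    have h := hup _ hc0 (by rw [Complex.conj_im]; linarith) hcv (by rw [Complex.conj_re]; exact hwre)
    rw [Complex.conj_im] at h
    rw [abs_of_neg hneg]
    exact h

/-- ★ (K) OCCUPANCY: for a real entire `f` with `f⁽ʲ⁾ ≢ 0`, an atomic touching pair `(v, z)` with `|Re z − Re v| ≤ (3/2)·Im v` has `z` in `v`'s own booked
`3/2`-tent: `1 ≤ tentAt (3/2) f j v` (the tent set is finite — it lies in the closed ball of radius `(3/2)·Im v + Im z` about `Re v` by the height bound). -/
theorem one_le_tentAt_of_strip {f : ℂ → ℂ} (hf : Differentiable ℂ f) (hreal : ∀ x : ℝ, (f (x : ℂ)).im = 0) {j : ℕ} (hne : iteratedDeriv j f ≠ 0)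
    {v z : ℂ} (hv : 0 < v.im) (ht : Touches f j v z) (ha : AtomicPair f j v z) (hre : |z.re - v.re| ≤ 3 / 2 * v.im) : 1 ≤ tentAt (3 / 2) f j v := by
  have hgd : Differentiable ℂ (iteratedDeriv j f) := Literature.Analysis.Complex.differentiable_iteratedDeriv_of_entire hf j
  have hvz : v.im < z.im := ht.2.1
  have hfin : (companions (iteratedDeriv j f) v.re (3 / 2 * v.im) v).Finite := by
    refine (finite_zeros_closedBall_of_entire hgd hne (v.re : ℂ) (3 / 2 * v.im + z.im)).subset ?_
    rintro w ⟨hw0, hwre, -, hwcv⟩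
    refine ⟨?_, hw0⟩
    rw [Metric.mem_closedBall, dist_eq_norm]
    have h1 : ‖w - (v.re : ℂ)‖ ≤ |w.re - v.re| + |w.im| := by simpa using Complex.norm_le_abs_re_add_abs_im (w - (v.re : ℂ))
    linarith [abs_im_le_of_strip hf hreal hv ht ha hw0 hwre hwcv]
  have hzv : z ≠ v := fun h => by rw [h] at hvz; exact lt_irrefl _ hvz
  have hzcv : z ≠ (starRingEnd ℂ) v := by intro h; have := congrArg Complex.im h; rw [Complex.conj_im] at this; linarith
  have hT : (↑({z} : Finset ℂ) : Set ℂ) ⊆ companions (iteratedDeriv j f) v.re (3 / 2 * v.im) v := by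
    intro w hw
    rw [Finset.coe_singleton, Set.mem_singleton_iff] at hw
    exact hw ▸ ⟨ht.1, hre, hzv, hzcv⟩
  have h := card_le_tentCount_of_subset hgd hne hfin hT
  rw [Finset.card_singleton, Nat.cast_one] at h
  exact h

/-- ★ (K) the near-coincident instance: `2‖v − z‖ < Im v ⇒ 1 ≤ tentAt (3/2) f j v` (atomic touching pair, real entire `f`, `f⁽ʲ⁾ ≢ 0`). -/
theorem one_le_tentAt_of_nearCoincident {f : ℂ → ℂ} (hf : Differentiable ℂ f) (hreal : ∀ x : ℝ, (f (x : ℂ)).im = 0) {j : ℕ}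
    (hne : iteratedDeriv j f ≠ 0) {v z : ℂ} (ht : Touches f j v z) (ha : AtomicPair f j v z) (hnc : 2 * ‖v - z‖ < v.im) :
    1 ≤ tentAt (3 / 2) f j v :=
  one_le_tentAt_of_strip hf hreal hne (by linarith [norm_nonneg (v - z)]) ht ha (abs_re_sub_le_of_nearCoincident hnc)

/-! ## §2 The anchored and the tie sub-sockets; the exact glue -/

/-- §2 regime 2′ ANCHORED (PROVED below, vacuous): near-coincident β-level above the floor at `v` whose OWN booked tent is empty, `tentAt (3/2) f j v < 1`. -/
def HeavyNearCoincidentAnchoredQ : Prop :=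
  ∀ (η : ℝ) (f : ℂ → ℂ) (x₀ s hmax R Hs : ℝ) (B : ℕ), EngineHyps5 2 η f x₀ s hmax R Hs B →
    ∀ (j : ℕ) (v z : ℂ), BetaLevel η f x₀ s hmax R Hs B j v z →
    30 ≤ v.im * stateKappa f j v → 2 * ‖v - z‖ < v.im → tentAt (3 / 2) f j v < 1 →
      5 / 2 ≤ ((v.im ^ 2 + z.im ^ 2) - childEnergy f j (pairUnion v z)) * stateKappa f j v ^ 2

/-- ★ §2 regime 2′ TIE (typed OPEN, substantive): near-coincident β-level above the floor at `v` on a TWIN-LOWEST frame — a second lowest tracked state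
`u ≠ v` of the same level and height, `Im u = Im v`, carries the empty booked tent `tentAt (3/2) f j u < 1`; then `X ≥ 5/2`. -/
def HeavyNearCoincidentTieQ : Prop :=
  ∀ (η : ℝ) (f : ℂ → ℂ) (x₀ s hmax R Hs : ℝ) (B : ℕ), EngineHyps5 2 η f x₀ s hmax R Hs B →
    ∀ (j : ℕ) (v z u : ℂ), BetaLevel η f x₀ s hmax R Hs B j v z →
    30 ≤ v.im * stateKappa f j v → 2 * ‖v - z‖ < v.im →
    IsLowest StTrkDQ η f x₀ s hmax R Hs B j u → u ≠ v → u.im = v.im → tentAt (3 / 2) f j u < 1 →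
      5 / 2 ≤ ((v.im ^ 2 + z.im ^ 2) - childEnergy f j (pairUnion v z)) * stateKappa f j v ^ 2

/-- ★ (K) §2 THE ANCHORED SUB-SOCKET HOLDS: a β-pair is tracked (`f⁽ʲ⁾ ≢ 0`), touching and atomic, so by §1 a near-coincident one occupies `v`'s own tent and
the clause `tentAt (3/2) f j v < 1` is contradictory (vacuous truth; no analysis). -/
theorem heavyNearCoincidentAnchoredQ_holds : HeavyNearCoincidentAnchoredQ := by
  intro η f x₀ s hmax R Hs B hE j v z hβ _ hnc htent
  exact absurd (one_le_tentAt_of_nearCoincident hE.1 hE.2.1 hβ.2.2.1.1.1 hβ.2.2.2.1 hβ.2.2.2.2 hnc) (not_le.mpr htent)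

/-- ★★ (K) §2 THE EXACT GLUE: regime 2′ ⟺ (anchored ∧ tie).  (⇒) drops binders; (⇐) the approach class of a β-level reads `¬Far ∧ ¬¬EmptyTrkDQ`: SOME lowest
tracked state `u` has `tentAt (3/2) f j u < 1` — if `u = v` the anchored socket answers, otherwise the tie socket does (`Im u = Im v` by lowestness). -/
theorem heavyNearCoincidentNoZQ_iff_anchored_and_tie :
    HeavyNearCoincidentNoZQ ↔ HeavyNearCoincidentAnchoredQ ∧ HeavyNearCoincidentTieQ := by
  constructor
  · intro h
    exact ⟨fun η f x₀ s hmax R Hs B hE j v z hβ hfl hnc _ => h η f x₀ s hmax R Hs B hE j v z hβ hfl hnc,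
      fun η f x₀ s hmax R Hs B hE j v z _ hβ hfl hnc _ _ _ _ => h η f x₀ s hmax R Hs B hE j v z hβ hfl hnc⟩
  · rintro ⟨hA, hT⟩ η f x₀ s hmax R Hs B hE j v z hβ hfl hnc
    obtain ⟨u, hu, htu⟩ : EmptyTrkDQ η f x₀ s hmax R Hs B j := not_not.mp hβ.2.1.2
    by_cases huv : u = v
    · rw [huv] at htu
      exact hA η f x₀ s hmax R Hs B hE j v z hβ hfl hnc htu
    · exact hT η f x₀ s hmax R Hs B hE j v z u hβ hfl hnc hu huv (le_antisymm (hu.2 v hβ.2.2.1.1) (hβ.2.2.1.2 u hu.1)) htu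

/-- ★ (K) §2 hence regime 2′ IS the tie socket: `HeavyNearCoincidentNoZQ ↔ HeavyNearCoincidentTieQ`. -/
theorem heavyNearCoincidentNoZQ_iff_tie : HeavyNearCoincidentNoZQ ↔ HeavyNearCoincidentTieQ :=
  ⟨fun h => (heavyNearCoincidentNoZQ_iff_anchored_and_tie.mp h).2,
   fun h => heavyNearCoincidentNoZQ_iff_anchored_and_tie.mpr ⟨heavyNearCoincidentAnchoredQ_holds, h⟩⟩

/-- ★ (K) §2 the z-floor-free heavy socket splits into TIE and MASS (`RhW08.K2NoZFloor.nearMassMonotonePairNoZQ_iff_split` by name). -/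
theorem nearMassMonotonePairNoZQ_iff_tie_mass {μ₀ : ℝ} : NearMassMonotonePairNoZQ μ₀ ↔ HeavyNearCoincidentTieQ ∧ HeavyMassNoZQ μ₀ := by
  rw [nearMassMonotonePairNoZQ_iff_split, heavyNearCoincidentNoZQ_iff_tie]

/-- ★ (K) §2 RUNG-P from the TIE socket and the MASS socket at `μ₀ = 1/2` (`RhW08.K2NoZFloor.rungP_of_two` by name; light side `k2Z` is in the tree). -/
theorem rungP_of_tie_mass (hT : HeavyNearCoincidentTieQ) (h₃ : HeavyMassNoZQ (1 / 2)) : RungP :=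
  rungP_of_two (heavyNearCoincidentNoZQ_iff_tie.mpr hT) h₃

/-! ## §3 (K) What the tie socket's binders force -/

/-- ★ (K) §3 TIE GEOMETRY: under the tie socket's binders `v`'s own tent is OCCUPIED, `1 ≤ tentAt (3/2) f j v`, and the twin lowest state `u` is
disc-separated from both members of the pair, `2·Im v < |Re v − Re u|` and `Im z + Im v < |Re z − Re u|` (atomicity at `u`: a tracked upper zero of `f⁽ʲ⁾`
of height `Im v < Im z`, distinct from `v` and `z`) — so `u` lies outside the strip of `v`'s tent and outside `Ū = pairUnion v z`. -/
theorem tie_geometry {η : ℝ} {f : ℂ → ℂ} {x₀ s hmax R Hs : ℝ} {B j : ℕ} {v z u : ℂ} (hE : EngineHyps5 2 η f x₀ s hmax R Hs B)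
    (hβ : BetaLevel η f x₀ s hmax R Hs B j v z) (hnc : 2 * ‖v - z‖ < v.im) (hu : IsLowest StTrkDQ η f x₀ s hmax R Hs B j u) (huv : u ≠ v)
    (him : u.im = v.im) : 1 ≤ tentAt (3 / 2) f j v ∧ 2 * v.im < |v.re - u.re| ∧ z.im + v.im < |z.re - u.re| := by
  have ht : Touches f j v z := hβ.2.2.2.1
  have huz : u ≠ z := by intro h; have h1 : v.im < z.im := ht.2.1; rw [← h, him] at h1; exact lt_irrefl _ h1
  have hsep := hβ.2.2.2.2 u hu.1.2.1 hu.1.2.2.1 huv huz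
  rw [him] at hsep
  exact ⟨one_le_tentAt_of_nearCoincident hE.1 hE.2.1 hβ.2.2.1.1.1 ht hβ.2.2.2.2 hnc, by linarith [hsep.1], hsep.2⟩

/-! ## §4 (K) The mass window of regime 3′ (director (CA802)(ii)/(CA803)(3): the analytic target is the window `μ ∈ (1/2, 1]`) -/

/-- ★ §4 regime 3′ WINDOW (typed OPEN, substantive): separated β-pair above the floor at `v`, NOT light within `μ₀` but light within `μ₁` ⇒ `X ≥ 5/2`
(the analytic target of record is the instance `(μ₀, μ₁) = (1/2, 1)`; benched heavy rows E14: `μ ∈ (1/2, .998]`, `X ≥ 3.478`). -/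
def HeavyMassWindowQ (μ₀ μ₁ : ℝ) : Prop :=
  ∀ (η : ℝ) (f : ℂ → ℂ) (x₀ s hmax R Hs : ℝ) (B : ℕ), EngineHyps5 2 η f x₀ s hmax R Hs B →
    ∀ (j : ℕ) (v z : ℂ), BetaLevel η f x₀ s hmax R Hs B j v z →
    30 ≤ v.im * stateKappa f j v → v.im ≤ 2 * ‖v - z‖ → ¬ LightPairAt μ₀ f j v z → LightPairAt μ₁ f j v z →
      5 / 2 ≤ ((v.im ^ 2 + z.im ^ 2) - childEnergy f j (pairUnion v z)) * stateKappa f j v ^ 2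

/-- ★ (K) §4 EXACT WINDOW SPLIT of the mass socket, `μ₀ ≤ μ₁`: `HeavyMassNoZQ μ₀ ↔ HeavyMassWindowQ μ₀ μ₁ ∧ HeavyMassNoZQ μ₁` (case on `LightPairAt μ₁`;
`RhW08.K2NoZFloor.heavyMassNoZQ_mono` by name for ⇒). -/
theorem heavyMassNoZQ_iff_window {μ₀ μ₁ : ℝ} (hμ : μ₀ ≤ μ₁) : HeavyMassNoZQ μ₀ ↔ HeavyMassWindowQ μ₀ μ₁ ∧ HeavyMassNoZQ μ₁ := by
  constructor
  · intro h
    exact ⟨fun η f x₀ s hmax R Hs B hE j v z hβ hfl hsep hnl _ => h η f x₀ s hmax R Hs B hE j v z hβ hfl hsep hnl, heavyMassNoZQ_mono hμ h⟩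
  · rintro ⟨hW, hH⟩ η f x₀ s hmax R Hs B hE j v z hβ hfl hsep hnl
    by_cases hl : LightPairAt μ₁ f j v z
    · exact hW η f x₀ s hmax R Hs B hE j v z hβ hfl hsep hnl hl
    · exact hH η f x₀ s hmax R Hs B hE j v z hβ hfl hsep hl

/-- ★ (K) §4 A WINDOW IS A CERTIFICATE PURCHASE: a z-floor-free perturbative drop law at `(C, μ₁)` with `C·(1 + μ₁) ≤ 15` closes every window below `μ₁`
(`λ_v ≥ 30 ⇒ 3 − C(1+μ₁)/λ_v ≥ 5/2`); e.g. `(60/7, 3/4)` would close `(1/2, 3/4]` — NOT BOUGHT ((CA798)/(CA802)(ii)), recorded so that the analytic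
content of 3′ reads exactly: the window above the best certified `μ₁`, plus `HeavyMassNoZQ μ₁`. -/
theorem heavyMassWindowQ_of_perturbative {C μ₀ μ₁ : ℝ} (hCμ : C * (1 + μ₁) ≤ 15) (hL : PerturbativeDropLightPairNoZQ C μ₁) :
    HeavyMassWindowQ μ₀ μ₁ := by
  intro η f x₀ s hmax R Hs B hE j v z hβ hfl _ _ hl
  have h := hL η f x₀ s hmax R Hs B hE j v z hβ hfl hl
  have hlpos : (0 : ℝ) < v.im * stateKappa f j v := by linarith
  have hq : C * (1 + μ₁) / (v.im * stateKappa f j v) ≤ 1 / 2 := by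
    rw [div_le_iff₀ hlpos]; nlinarith
  linarith

/-- ★ (K) §4 RUNG-P BOOKKEEPING after this file: TIE socket + mass WINDOW `(1/2, μ₁]` + mass socket above `μ₁` (any `μ₁ ≥ 1/2`) ⟹ RUNG-P. -/
theorem rungP_of_tie_window_mass {μ₁ : ℝ} (hμ : 1 / 2 ≤ μ₁) (hT : HeavyNearCoincidentTieQ) (hW : HeavyMassWindowQ (1 / 2) μ₁)
    (hH : HeavyMassNoZQ μ₁) : RungP :=
  rungP_of_tie_mass hT ((heavyMassNoZQ_iff_window hμ).mpr ⟨hW, hH⟩)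

end RhW08.NearCoincidentTie
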